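import Summits.Ventures.LatticeQCDFlow.Exactness.Phi4HMCFluctuationRelation
import Literature.Probability.HeavyTails.LogNormalTailHillTarget
import HarnessLib

/-!
# The exact free-field check of the LOCAL arm with the engine's WINDOW step: the Metropolis update
# `φ ↦ φ + u`, `u ∼ U[−δ, δ]`, on a Gaussian mode `N(0, a)` is accepted with probability EXACTLY
# `ā = 2Φ̄(D) + (2/D)·(φ(0) − φ(D))`, `D = δ/(2√a)` (`Φ̄`, `φ` the standard normal tail and density)

HONEST FRAMING: exact (Metropolis-corrected) sampling algorithms for lattice gauge theory;
figures of merit are autocorrelation/cost numbers at stated couplings and volumes; no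
continuum-physics claim.  (SCALAR calibration rung S0-A: not a gauge result.)

Venture `LatticeQCDFlow` (cell pub-lqcd), topic `Exactness`; FANOUT row 2 (`s0-phi4`, LOCAL arm; the
battery's "exact free-field limit check" for the uniform-window proposal that the calibration engine
uses, `Phi4MetropolisWindowComparison` / `Phi4MetropolisSiteMeanEnergyChange`).  NEW WORK of the cell,
the window twin of `GaussianMetropolisSiteAcceptance` (Gaussian steps: `(2/π)·arctan(2√a/√v)`).
Ingredients, all the tree's: row 2's involution framework `Phi4HMCFluctuationRelation`
(`acceptance_integral_eq`; here on the base measure `Leb|[−δ,δ] ⊗ Leb`, which the shear-and-flip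
`(u, φ) ↦ (−u, φ + u)` preserves — so a step law vanishing off a set, which row 2's
`Phi4MetropolisSiteInvolution` excludes, is handled by restricting the base measure), Mathlib's
Gaussian push-forwards, and the Literature file `Probability/HeavyTails/LogNormalTailHillTarget`
(`GaussianTail.hasDerivAt_mul_tail_sub_pdf`: `(yΦ̄(y) − φ(y))' = Φ̄(y)` [Belzunce–Riquelme–Mulero],
`GaussianTail.continuous_tail`).  Nothing is cited as a fact here; no definition.

ROUTE.  `ΔS = u(2φ+u)/(2a)`; the sign rule gives `∫ min(1,e^{−ΔS}) p_a dμ_δ = P(ΔS ≤ 0) + P(ΔS < 0)`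
(unnormalised, window mass `2δ`); for `u ≠ 0` the inner probability is `P(Φ < −u/2) = Φ̄(u/(2√a))`
(`u > 0`) resp. `P(Φ > |u|/2) = Φ̄(|u|/(2√a))` (`u < 0`), ties being one point; integrating over the
window, `∫_{−δ}^{δ} Φ̄(|u|/(2√a)) du = 4√a ∫₀^D Φ̄ = 4√a (DΦ̄(D) − φ(D) + φ(0))`.

## What is proved (`a : ℝ≥0`, `a ≠ 0`; `δ > 0`; `μ_δ = Leb|[−δ,δ] ⊗ Leb` on `(u, φ)`)

* §1 `measurePreserving_neg_restrict_Icc`, `measurePreserving_rwShear_window`, `deltaH_window_eq`,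
  **`windowSite_acceptance_eq_signProb`** (the window sign rule);
* §2 `gaussianReal_real_Iio_neg`, `gaussianReal_real_Ioi` (`N(0,a)` tails in standard units),
  `integral_ite_mul_gaussianPDFReal`, **`windowSite_inner_lt`** / `windowSite_inner_le`
  (`= Φ̄(|u|/(2√a))` for `u ≠ 0`);
* §3 `intervalIntegral_gaussianTail` (`∫₀^D Φ̄ = DΦ̄(D) − φ(D) + φ(0)`), `integral_window_tail_abs`,
  **`windowSite_meanAccept`** —
  `∫_{[−δ,δ]×ℝ} min(1, e^{−ΔS}) p_a(φ) du dφ = 4δ·Φ̄(D) + 8√a·(φ(0) − φ(D))`,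
  **`windowSite_meanAccept_normalised`** — divided by `2δ`: `ā = 2Φ̄(D) + (2/D)(φ(0) − φ(D))`.

Reading for S0-A (no numerics implied beyond displayed constants): a certified test value for the
engine's window update at `λ = 0`, per mode (or per site of a free lattice field with `a = 1/A_xx`,
reading as in the Gaussian-step file): `ā → 1` as `D → 0` (`1 − ā ∼ D/√(2π)·…`), and
`ā ≈ (2/D)φ(0) = 4σ/(δ√(2π))` for wide windows — the local arm's large-step cost law with its
constant.  NOT CLAIMED: `λ > 0`; many-site acceptances; the optimal `δ`; any value for any run.
-/

namespace Summit.Ventures.LatticeQCDFlow.Exactness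

open Real MeasureTheory ProbabilityTheory Filter Set
open scoped NNReal ENNReal

section WindowSite

variable {a : ℝ≥0} {δ : ℝ}

/-! ## §1 The window site update on a Gaussian mode as an involution of `[−δ, δ] × ℝ` -/

/-- The flip `u ↦ −u` preserves Lebesgue measure restricted to the symmetric window. -/
theorem measurePreserving_neg_restrict_Icc (δ : ℝ) :
    MeasurePreserving (fun u : ℝ => -u) ((volume : Measure ℝ).restrict (Icc (-δ) δ))
      ((volume : Measure ℝ).restrict (Icc (-δ) δ)) := by
  have h := (Measure.measurePreserving_neg (volume : Measure ℝ)).restrict_preimage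
    (measurableSet_Icc : MeasurableSet (Icc (-δ) δ))
  have hpre : (fun u : ℝ => -u) ⁻¹' Icc (-δ) δ = Icc (-δ) δ := by
    ext u; simp only [mem_preimage, mem_Icc]; constructor <;> intro h <;> constructor <;> linarith [h.1, h.2]
  rwa [hpre] at h

/-- The shear-and-flip `Ψ(u, φ) = (−u, φ + u)` preserves `Leb|[−δ,δ] ⊗ Leb`. -/
theorem measurePreserving_rwShear_window (δ : ℝ) :
    MeasurePreserving (fun p : ℝ × ℝ => (-p.1, p.2 + p.1))
      (((volume : Measure ℝ).restrict (Icc (-δ) δ)).prod (volume : Measure ℝ))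
      (((volume : Measure ℝ).restrict (Icc (-δ) δ)).prod (volume : Measure ℝ)) := by
  have hgm : Measurable (Function.uncurry fun (u : ℝ) (φ : ℝ) => φ + u) := measurable_snd.add measurable_fst
  exact MeasurePreserving.skew_product (μc := (volume : Measure ℝ)) (μd := (volume : Measure ℝ))
    (measurePreserving_neg_restrict_Icc δ) hgm
    (Eventually.of_forall fun u => (measurePreserving_add_right (volume : Measure ℝ) u).map_eq)

/-- `Ψ` is measurable. -/
theorem measurable_rwShear_window' : Measurable (fun p : ℝ × ℝ => (-p.1, p.2 + p.1)) :=
  measurable_fst.neg.prodMk (measurable_snd.add measurable_fst)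

/-- `Ψ` is an involution. -/
theorem rwShear_window_involutive : Function.Involutive (fun p : ℝ × ℝ => (-p.1, p.2 + p.1)) := by
  intro p; ext <;> simp

/-- With `H(u, φ) = −log p_a(φ)` (the window's constant density is carried by the base measure) the
violation of `Ψ` is the proposed action change `ΔS = u(2φ + u)/(2a)`. -/
theorem deltaH_window_eq (ha : a ≠ 0) (p : ℝ × ℝ) :
    deltaH (fun q : ℝ × ℝ => -Real.log (gaussianPDFReal 0 a q.2)) (fun q => (-q.1, q.2 + q.1)) p
      = p.1 * (2 * p.2 + p.1) / (2 * a) := by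
  have ha' : (a : ℝ) ≠ 0 := NNReal.coe_ne_zero.mpr ha
  unfold deltaH
  simp only [gaussianPDFReal_def, sub_zero]
  rw [Real.log_mul (by positivity) (Real.exp_pos _).ne', Real.log_mul (by positivity) (Real.exp_pos _).ne',
    Real.log_exp, Real.log_exp]
  field_simp
  ring

/-- **THE WINDOW SIGN RULE ON THE MODE**: with `μ_δ = Leb|[−δ,δ] ⊗ Leb`,
`∫ min(1, e^{−ΔS}) p_a(φ) dμ_δ = ∫ 𝟙[ΔS ≤ 0] p_a dμ_δ + ∫ 𝟙[ΔS < 0] p_a dμ_δ`. -/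
theorem windowSite_acceptance_eq_signProb (ha : a ≠ 0) (δ : ℝ) :
    ∫ p : ℝ × ℝ, min 1 (Real.exp (-(p.1 * (2 * p.2 + p.1) / (2 * a)))) * gaussianPDFReal 0 a p.2
        ∂(((volume : Measure ℝ).restrict (Icc (-δ) δ)).prod (volume : Measure ℝ))
      = (∫ p : ℝ × ℝ, (if p.1 * (2 * p.2 + p.1) / (2 * a) ≤ 0 then (1 : ℝ) else 0) * gaussianPDFReal 0 a p.2
          ∂(((volume : Measure ℝ).restrict (Icc (-δ) δ)).prod (volume : Measure ℝ)))
        + ∫ p : ℝ × ℝ, (if p.1 * (2 * p.2 + p.1) / (2 * a) < 0 then (1 : ℝ) else 0) * gaussianPDFReal 0 a p.2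
          ∂(((volume : Measure ℝ).restrict (Icc (-δ) δ)).prod (volume : Measure ℝ)) := by
  have hHm : Measurable (fun q : ℝ × ℝ => -Real.log (gaussianPDFReal 0 a q.2)) :=
    (Real.measurable_log.comp ((measurable_gaussianPDFReal 0 a).comp measurable_snd)).neg
  have hexp_eq : ∀ q : ℝ × ℝ, Real.exp (-(-Real.log (gaussianPDFReal 0 a q.2))) = gaussianPDFReal 0 a q.2 := by
    intro q; rw [neg_neg, Real.exp_log (gaussianPDFReal_pos _ _ _ ha)]
  have hexp : Integrable (fun q : ℝ × ℝ => Real.exp (-(-Real.log (gaussianPDFReal 0 a q.2))))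
      (((volume : Measure ℝ).restrict (Icc (-δ) δ)).prod (volume : Measure ℝ)) := by
    simp_rw [hexp_eq]
    have h : Integrable (fun q : ℝ × ℝ => (1 : ℝ) * gaussianPDFReal 0 a q.2)
        (((volume : Measure ℝ).restrict (Icc (-δ) δ)).prod (volume : Measure ℝ)) :=
      (integrable_const (1 : ℝ)).mul_prod (integrable_gaussianPDFReal 0 a)
    simpa using h
  have h := acceptance_integral_eq hHm measurable_rwShear_window' rwShear_window_involutive
    (measurePreserving_rwShear_window δ) hexp
  simp only [deltaH_window_eq ha, hexp_eq] at h
  exact h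

/-! ## §2 The inner Gaussian probabilities: `P(Φ < −u/2) = Φ̄(u/(2√a))` -/

/-- `N(0, a)` is the image of `N(0, 1)` under `x ↦ √a x`. -/
private theorem gaussianReal_eq_map_sqrt (a : ℝ≥0) :
    gaussianReal 0 a = (gaussianReal 0 1).map (fun x => Real.sqrt (a : ℝ) * x) := by
  rw [gaussianReal_map_const_mul, mul_zero]
  congr 1
  apply NNReal.eq
  simp [Real.sq_sqrt a.coe_nonneg]

/-- Lower Gaussian tail in standard units: `N(0,a)(−∞, −x) = Φ̄(x/√a)` (`a ≠ 0`). -/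
theorem gaussianReal_real_Iio_neg (ha : a ≠ 0) (x : ℝ) :
    (gaussianReal 0 a).real (Iio (-x)) = (gaussianReal (0 : ℝ) 1).real (Ioi (x / Real.sqrt a)) := by
  have ha' : (0 : ℝ) < a := by exact_mod_cast pos_iff_ne_zero.mpr ha
  have hs : 0 < Real.sqrt (a : ℝ) := Real.sqrt_pos.mpr ha'
  rw [gaussianReal_eq_map_sqrt a, map_measureReal_apply (measurable_const_mul _) measurableSet_Iio]
  have hpre : (fun y : ℝ => Real.sqrt (a : ℝ) * y) ⁻¹' Iio (-x) = Iio (-(x / Real.sqrt a)) := by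
    ext y
    simp only [mem_preimage, mem_Iio]
    rw [show -(x / Real.sqrt a) = (-x) / Real.sqrt a by ring, lt_div_iff₀ hs]
    constructor <;> intro h <;> linarith [mul_comm y (Real.sqrt a)]
  rw [hpre]
  have hsymm : (gaussianReal (0 : ℝ) 1).map (fun y => -y) = gaussianReal 0 1 := by
    rw [gaussianReal_map_neg, neg_zero]
  conv_lhs => rw [← hsymm]
  rw [map_measureReal_apply measurable_neg measurableSet_Iio]
  congr 1
  ext y
  simp

/-- Upper Gaussian tail in standard units: `N(0,a)(x, ∞) = Φ̄(x/√a)` (`a ≠ 0`). -/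
theorem gaussianReal_real_Ioi (ha : a ≠ 0) (x : ℝ) :
    (gaussianReal 0 a).real (Ioi x) = (gaussianReal (0 : ℝ) 1).real (Ioi (x / Real.sqrt a)) := by
  have ha' : (0 : ℝ) < a := by exact_mod_cast pos_iff_ne_zero.mpr ha
  have hs : 0 < Real.sqrt (a : ℝ) := Real.sqrt_pos.mpr ha'
  rw [gaussianReal_eq_map_sqrt a, map_measureReal_apply (measurable_const_mul _) measurableSet_Ioi]
  congr 1
  ext y
  simp only [mem_preimage, mem_Ioi]
  rw [div_lt_iff₀ hs, mul_comm]

/-- A weighted indicator integral against `p_a` is an `N(0,a)`-probability. -/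
theorem integral_ite_mul_gaussianPDFReal (ha : a ≠ 0) {S : Set ℝ} (hS : MeasurableSet S)
    [DecidablePred (· ∈ S)] :
    ∫ φ, (if φ ∈ S then (1 : ℝ) else 0) * gaussianPDFReal 0 a φ = (gaussianReal 0 a).real S := by
  have e : (fun φ : ℝ => (if φ ∈ S then (1 : ℝ) else 0) * gaussianPDFReal 0 a φ)
      = S.indicator (gaussianPDFReal 0 a) := by
    funext φ
    by_cases h : φ ∈ S
    · rw [if_pos h, indicator_of_mem h, one_mul]
    · rw [if_neg h, indicator_of_notMem h, zero_mul]
  rw [e, integral_indicator hS, measureReal_def, gaussianReal_apply_eq_integral _ ha,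
    ENNReal.toReal_ofReal (setIntegral_nonneg hS fun x _ => gaussianPDFReal_nonneg _ _ _)]

/-- **The inner probability**: for `u ≠ 0`,
`∫ 𝟙[u(2φ+u)/(2a) < 0] p_a(φ) dφ = Φ̄(|u|/(2√a))`. -/
theorem windowSite_inner_lt (ha : a ≠ 0) {u : ℝ} (hu : u ≠ 0) :
    ∫ φ, (if u * (2 * φ + u) / (2 * a) < 0 then (1 : ℝ) else 0) * gaussianPDFReal 0 a φ
      = (gaussianReal (0 : ℝ) 1).real (Ioi (|u| / (2 * Real.sqrt a))) := by
  have ha' : (0 : ℝ) < a := by exact_mod_cast pos_iff_ne_zero.mpr ha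
  rcases lt_or_gt_of_ne hu with hneg | hpos
  · -- `u < 0`: the event is `φ > −u/2 = |u|/2`
    have hset : ∀ φ : ℝ, (u * (2 * φ + u) / (2 * a) < 0) ↔ φ ∈ Ioi (|u| / 2) := by
      intro φ
      rw [mem_Ioi, abs_of_neg hneg, div_lt_iff₀ (by positivity : (0 : ℝ) < 2 * a), zero_mul]
      constructor
      · intro h; nlinarith
      · intro h; nlinarith
    simp only [hset]
    rw [integral_ite_mul_gaussianPDFReal ha measurableSet_Ioi, gaussianReal_real_Ioi ha]
    congr 2
    field_simp
  · have hset : ∀ φ : ℝ, (u * (2 * φ + u) / (2 * a) < 0) ↔ φ ∈ Iio (-(|u| / 2)) := by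
      intro φ
      rw [mem_Iio, abs_of_pos hpos, div_lt_iff₀ (by positivity : (0 : ℝ) < 2 * a), zero_mul]
      constructor
      · intro h; nlinarith
      · intro h; nlinarith
    simp only [hset]
    rw [integral_ite_mul_gaussianPDFReal ha measurableSet_Iio, gaussianReal_real_Iio_neg ha]
    congr 2
    field_simp

/-- The closed event has the same inner probability (`u ≠ 0`; one boundary point). -/
theorem windowSite_inner_le (ha : a ≠ 0) {u : ℝ} (hu : u ≠ 0) :
    ∫ φ, (if u * (2 * φ + u) / (2 * a) ≤ 0 then (1 : ℝ) else 0) * gaussianPDFReal 0 a φ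
      = (gaussianReal (0 : ℝ) 1).real (Ioi (|u| / (2 * Real.sqrt a))) := by
  have ha' : (0 : ℝ) < a := by exact_mod_cast pos_iff_ne_zero.mpr ha
  haveI := nullSingletonClass_gaussianReal (μ := (0 : ℝ)) (v := a) ha
  rw [← windowSite_inner_lt ha hu]
  rcases lt_or_gt_of_ne hu with hneg | hpos
  · have hset1 : ∀ φ : ℝ, (u * (2 * φ + u) / (2 * a) ≤ 0) ↔ φ ∈ Ici (-(u / 2)) := by
      intro φ
      rw [mem_Ici, div_le_iff₀ (by positivity : (0 : ℝ) < 2 * a), zero_mul]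
      constructor
      · intro h; nlinarith
      · intro h; nlinarith
    have hset2 : ∀ φ : ℝ, (u * (2 * φ + u) / (2 * a) < 0) ↔ φ ∈ Ioi (-(u / 2)) := by
      intro φ
      rw [mem_Ioi, div_lt_iff₀ (by positivity : (0 : ℝ) < 2 * a), zero_mul]
      constructor
      · intro h; nlinarith
      · intro h; nlinarith
    simp only [hset1, hset2]
    rw [integral_ite_mul_gaussianPDFReal ha measurableSet_Ici, integral_ite_mul_gaussianPDFReal ha measurableSet_Ioi]
    exact measureReal_congr Ioi_ae_eq_Ici.symm
  · have hset1 : ∀ φ : ℝ, (u * (2 * φ + u) / (2 * a) ≤ 0) ↔ φ ∈ Iic (-(u / 2)) := by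
      intro φ
      rw [mem_Iic, div_le_iff₀ (by positivity : (0 : ℝ) < 2 * a), zero_mul]
      constructor
      · intro h; nlinarith
      · intro h; nlinarith
    have hset2 : ∀ φ : ℝ, (u * (2 * φ + u) / (2 * a) < 0) ↔ φ ∈ Iio (-(u / 2)) := by
      intro φ
      rw [mem_Iio, div_lt_iff₀ (by positivity : (0 : ℝ) < 2 * a), zero_mul]
      constructor
      · intro h; nlinarith
      · intro h; nlinarith
    simp only [hset1, hset2]
    rw [integral_ite_mul_gaussianPDFReal ha measurableSet_Iic, integral_ite_mul_gaussianPDFReal ha measurableSet_Iio]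
    exact measureReal_congr Iio_ae_eq_Iic.symm

/-! ## §3 The outer window average and the closed form -/

/-- `∫₀^D Φ̄ = D·Φ̄(D) − φ(D) + φ(0)` (the tree's antiderivative `(yΦ̄(y) − φ(y))' = Φ̄(y)`,
`Literature/Probability/HeavyTails/LogNormalTailHillTarget`). -/
theorem intervalIntegral_gaussianTail (D : ℝ) :
    ∫ y in (0 : ℝ)..D, (gaussianReal (0 : ℝ) 1).real (Ioi y)
      = D * (gaussianReal (0 : ℝ) 1).real (Ioi D) - gaussianPDFReal 0 1 D + gaussianPDFReal 0 1 0 := by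
  rw [intervalIntegral.integral_eq_sub_of_hasDerivAt
    (fun x _ => Literature.Probability.HeavyTails.GaussianTail.hasDerivAt_mul_tail_sub_pdf x)
    (Literature.Probability.HeavyTails.GaussianTail.continuous_tail.intervalIntegrable _ _)]
  ring

/-- The window average of the inner tail: `∫_{[−δ,δ]} Φ̄(|u|/(2√a)) du = 4√a·∫₀^{δ/(2√a)} Φ̄`. -/
theorem integral_window_tail_abs (ha : a ≠ 0) (hδ : 0 < δ) :
    ∫ u in Icc (-δ) δ, (gaussianReal (0 : ℝ) 1).real (Ioi (|u| / (2 * Real.sqrt a)))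
      = 2 * (2 * Real.sqrt a) * ∫ y in (0 : ℝ)..δ / (2 * Real.sqrt a), (gaussianReal (0 : ℝ) 1).real (Ioi y) := by
  have ha' : (0 : ℝ) < a := by exact_mod_cast pos_iff_ne_zero.mpr ha
  have hc : (2 * Real.sqrt (a : ℝ)) ≠ 0 := by positivity
  -- as an integral of a function of `|u|` over the whole line
  have e1 : ∫ u in Icc (-δ) δ, (gaussianReal (0 : ℝ) 1).real (Ioi (|u| / (2 * Real.sqrt a)))
      = ∫ u, (Iic δ).indicator (fun y => (gaussianReal (0 : ℝ) 1).real (Ioi (y / (2 * Real.sqrt a)))) |u| := by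
    rw [← integral_indicator measurableSet_Icc]
    refine integral_congr_ae (Eventually.of_forall fun u => ?_)
    dsimp only
    by_cases hu : u ∈ Icc (-δ) δ
    · rw [indicator_of_mem hu, indicator_of_mem (mem_Iic.mpr (abs_le.mpr ⟨by linarith [hu.1], hu.2⟩))]
    · rw [indicator_of_notMem hu, indicator_of_notMem]
      intro h
      exact hu (abs_le.mp (mem_Iic.mp h) |> fun h2 => ⟨by linarith [h2.1], h2.2⟩)
  have hdiv := intervalIntegral.integral_comp_div (f := fun y => (gaussianReal (0 : ℝ) 1).real (Ioi y))
    (a := 0) (b := δ) hc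
  simp only [zero_div, smul_eq_mul] at hdiv
  rw [e1, integral_comp_abs (f := (Iic δ).indicator (fun y => (gaussianReal (0 : ℝ) 1).real
    (Ioi (y / (2 * Real.sqrt a))))), setIntegral_indicator measurableSet_Iic,
    show Ioi (0 : ℝ) ∩ Iic δ = Ioc 0 δ from rfl, ← intervalIntegral.integral_of_le hδ.le, hdiv]
  ring

/-- **THE EXACT ACCEPTANCE OF THE UNIFORM-WINDOW METROPOLIS UPDATE ON A GAUSSIAN MODE**: target
`N(0, a)`, proposal `φ ↦ φ + u` with `u` uniform on `[−δ, δ]` (`a ≠ 0`, `δ > 0`); with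
`Φ̄(t) = N(0,1)(t, ∞)`, `φ` the standard normal density and `D = δ/(2√a)`:
`∫_{[−δ,δ]×ℝ} min(1, e^{−u(2φ+u)/(2a)}) p_a(φ) du dφ = 4δ·Φ̄(D) + 8√a·(φ(0) − φ(D))`
(the window's mass `2δ` times the acceptance `2Φ̄(D) + (2/D)(φ(0) − φ(D))`). -/
theorem windowSite_meanAccept (ha : a ≠ 0) (hδ : 0 < δ) :
    ∫ p : ℝ × ℝ, min 1 (Real.exp (-(p.1 * (2 * p.2 + p.1) / (2 * a)))) * gaussianPDFReal 0 a p.2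
        ∂(((volume : Measure ℝ).restrict (Icc (-δ) δ)).prod (volume : Measure ℝ))
      = 4 * δ * (gaussianReal (0 : ℝ) 1).real (Ioi (δ / (2 * Real.sqrt a)))
        + 8 * Real.sqrt a * (gaussianPDFReal 0 1 0 - gaussianPDFReal 0 1 (δ / (2 * Real.sqrt a))) := by
  have ha' : (0 : ℝ) < a := by exact_mod_cast pos_iff_ne_zero.mpr ha
  have hsa : 0 < Real.sqrt (a : ℝ) := Real.sqrt_pos.mpr ha'
  rw [windowSite_acceptance_eq_signProb ha δ]
  -- Fubini for both sign integrals
  have hf : Measurable fun p : ℝ × ℝ => p.1 * (2 * p.2 + p.1) / (2 * a) :=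
    (measurable_fst.mul ((measurable_snd.const_mul 2).add measurable_fst)).div_const _
  have hpm : Measurable fun p : ℝ × ℝ => gaussianPDFReal 0 a p.2 :=
    (measurable_gaussianPDFReal 0 a).comp measurable_snd
  have hdom : Integrable (fun p : ℝ × ℝ => (1 : ℝ) * gaussianPDFReal 0 a p.2)
      (((volume : Measure ℝ).restrict (Icc (-δ) δ)).prod (volume : Measure ℝ)) :=
    (integrable_const (1 : ℝ)).mul_prod (integrable_gaussianPDFReal 0 a)
  have hint : ∀ (c : ℝ × ℝ → Prop) [DecidablePred c], (Measurable fun p => if c p then (1 : ℝ) else 0) →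
      Integrable (fun p : ℝ × ℝ => (if c p then (1 : ℝ) else 0) * gaussianPDFReal 0 a p.2)
        (((volume : Measure ℝ).restrict (Icc (-δ) δ)).prod (volume : Measure ℝ)) := by
    intro c _ hc
    refine hdom.mono' (hc.mul hpm).aestronglyMeasurable (Eventually.of_forall fun p => ?_)
    have h0 : 0 ≤ gaussianPDFReal 0 a p.2 := gaussianPDFReal_nonneg _ _ _
    rw [Real.norm_eq_abs, abs_of_nonneg (mul_nonneg (by split_ifs <;> norm_num) h0)]
    exact mul_le_mul_of_nonneg_right (by split_ifs <;> norm_num) h0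
  have hIle := hint (fun p => p.1 * (2 * p.2 + p.1) / (2 * a) ≤ 0)
    (Measurable.ite (measurableSet_le hf measurable_const) measurable_const measurable_const)
  have hIlt := hint (fun p => p.1 * (2 * p.2 + p.1) / (2 * a) < 0)
    (Measurable.ite (measurableSet_lt hf measurable_const) measurable_const measurable_const)
  rw [integral_prod _ hIle, integral_prod _ hIlt]
  -- off the null set `u = 0` both inner integrals are `Φ̄(|u|/(2√a))`
  have hae : ∀ᵐ u ∂((volume : Measure ℝ).restrict (Icc (-δ) δ)), u ≠ 0 := by
    refine ae_restrict_of_ae ?_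
    rw [ae_iff]
    simp
  have e_le : ∫ u, (∫ φ, (if ((u, φ) : ℝ × ℝ).1 * (2 * ((u, φ) : ℝ × ℝ).2 + ((u, φ) : ℝ × ℝ).1) / (2 * a) ≤ 0
      then (1 : ℝ) else 0) * gaussianPDFReal 0 a ((u, φ) : ℝ × ℝ).2)
      ∂((volume : Measure ℝ).restrict (Icc (-δ) δ))
      = ∫ u in Icc (-δ) δ, (gaussianReal (0 : ℝ) 1).real (Ioi (|u| / (2 * Real.sqrt a))) := by
    refine integral_congr_ae (hae.mono fun u hu => ?_)
    simp only
    exact windowSite_inner_le ha hu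
  have e_lt : ∫ u, (∫ φ, (if ((u, φ) : ℝ × ℝ).1 * (2 * ((u, φ) : ℝ × ℝ).2 + ((u, φ) : ℝ × ℝ).1) / (2 * a) < 0
      then (1 : ℝ) else 0) * gaussianPDFReal 0 a ((u, φ) : ℝ × ℝ).2)
      ∂((volume : Measure ℝ).restrict (Icc (-δ) δ))
      = ∫ u in Icc (-δ) δ, (gaussianReal (0 : ℝ) 1).real (Ioi (|u| / (2 * Real.sqrt a))) := by
    refine integral_congr_ae (hae.mono fun u hu => ?_)
    simp only
    exact windowSite_inner_lt ha hu
  rw [e_le, e_lt, integral_window_tail_abs ha hδ, intervalIntegral_gaussianTail]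
  have hc : 2 * Real.sqrt (a : ℝ) ≠ 0 := by positivity
  field_simp
  ring

/-- **NORMALISED FORM**: dividing by the window mass `2δ`, the acceptance is
`ā = 2Φ̄(D) + (2/D)(φ(0) − φ(D))`, `D = δ/(2√a)` — it tends to `1` as `D → 0` and decays like
`(2/D)φ(0) = 4σ/(δ√(2π))` for large windows. -/
theorem windowSite_meanAccept_normalised (ha : a ≠ 0) (hδ : 0 < δ) :
    (∫ p : ℝ × ℝ, min 1 (Real.exp (-(p.1 * (2 * p.2 + p.1) / (2 * a)))) * gaussianPDFReal 0 a p.2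
        ∂(((volume : Measure ℝ).restrict (Icc (-δ) δ)).prod (volume : Measure ℝ))) / (2 * δ)
      = 2 * (gaussianReal (0 : ℝ) 1).real (Ioi (δ / (2 * Real.sqrt a)))
        + 2 / (δ / (2 * Real.sqrt a)) * (gaussianPDFReal 0 1 0 - gaussianPDFReal 0 1 (δ / (2 * Real.sqrt a))) := by
  have ha' : (0 : ℝ) < a := by exact_mod_cast pos_iff_ne_zero.mpr ha
  have hsa : 0 < Real.sqrt (a : ℝ) := Real.sqrt_pos.mpr ha'
  rw [windowSite_meanAccept ha hδ]
  field_simp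
  ring

end WindowSite

end Summit.Ventures.LatticeQCDFlow.Exactness
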